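import Summits.Schanuel.Schanuel.Theses.RoyCriterion
import Summits.Schanuel.Schanuel.Theorems.RoyCriterionRoySmallValueDirichletGapStubEnemyOrbitsStep2
import Summits.Schanuel.Schanuel.Theorems.RoyCriterionRoySmallValueDirichletGapStubEnemyOrbitsStep3
import Summits.Schanuel.Schanuel.Theorems.RoyCriterionRoySmallValueDirichletGapDefs
import Literature.NumberTheory.Transcendental.RoySmallValueMain

/-!
# Route `RoyCriterion`, crux `RoySmallValueDirichletGap` (stmt-Schanuel-1050), line
# `two-sided-absorption-transfer` — stub `StubEnemyOrbits`

We prove `stub_enemyOrbits`: at a point `(ξ, η) ∈ ℂ × ℂˣ` NOT in `ℚ̄²`, the small-value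
hypothesis `SmallValueHyp ξ η β τ ν` with `1 < τ < 2`, `β > τ` and `ν = 2 + β − τ + δ`, `δ > 0`
(i.e. `ν` anywhere above the Dirichlet exponent, NOT above Roy's `2 + β − τ + (τ−1)(2−τ)/(β+1−τ)`)
yields `HasOrbitLinks ξ η β τ δ`: for the constant `C = max(1280, 74·2^{1+β−τ})` and every large
level `D`, a configuration of zeros `Z` over a normal number field `closureField S`, an orbit
`O = Z.orb j₀` and a level `D*` forming an orbit link (`IsOrbitLink`: chart, positivity of the
distances, `1 ≤ D* < D`, size `#O ≤ C (D*)^{2−τ}`, height `h(O) ≤ C (D*)^{1+β−τ}`, the Step-2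
mass inequality at depth `⌊D^τ⌋` and the Step-4 inequality at depth `⌊(D*)^τ⌋` on every
`𝒮 ⊆ O ∩ 𝒰`).

This is Roy 2013, §7, Steps 1–4, which never use the lower bound on `ν` (it enters only in Step 5).
The proof re-runs the tree's kernel-checked proof of Roy's Theorem 1.1
(`Literature.NumberTheory.Transcendental.Roy2013.roy2013_thm_1_1_holds`) with the frame
"for every `N` a level `D ≥ N`" replaced by "every `D ≥ max D₃ (D₁ + 2)`" and the endgame removed:
the preparations (exponents, thresholds `D₁`, the forms `P̃_n = royTilde n P_n` and their bodies
`𝒞_n`, the level packages `L_n`, the separation `ε₁` at the level `D₁ + 1` and its threshold `D₃`)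
are verbatim; Step 2 at the level `D` is `level_step2` (file `…StubEnemyOrbitsStep2`), Steps 3–4 are
`level_step34` (file `…StubEnemyOrbitsStep3`); the eight clauses are then read off with the single
constant `C` (`C ≥ 1/κ = 1280` for the mass clause, `C ≥ A₃ = 74·2^{1+β−τ}` for the height,
`C ≥ 8` for the size and Step 4).

## References

* [Roy2013] D. Roy, *A small value estimate for 𝔾ₐ × 𝔾ₘ*, Mathematika 59 (2013), 333–363
  (arXiv:1301.0663), §7.
-/

-- `Summit.Schanuel.Schanuel.…` is the mandated layout of this single-problem summit (CONVENTIONS §1).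
set_option linter.dupNamespace false

noncomputable section

namespace Summit.Schanuel.Schanuel.Theorems.RoyLinks

open Filter MvPolynomial Finset Height
open Literature.NumberTheory.Transcendental
open Literature.NumberTheory.Transcendental.Roy2013
open Summit.Schanuel.Schanuel.Theses.RoyCriterion (RoySmallValueDirichletGap)

/-! ## Stub `StubEnemyOrbits` -/

/-- **Enemy orbits (Roy 2013 §7 Steps 1–4, exposed; stub of line `two-sided-absorption-transfer`).**
At `(ξ, η)`, `η ≠ 0`, not in `ℚ̄²`, the small-value hypothesis with `1 < τ < 2`, `β > τ`,
`ν = 2 + β − τ + δ`, `δ > 0` yields orbit links at every large level `D`.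
[cite: Roy2013, §7, Steps 1–4, pp. 18–19] -/
theorem stub_enemyOrbits (ξ η : ℂ) (hη : η ≠ 0) (hna : ¬(IsAlgebraic ℚ ξ ∧ IsAlgebraic ℚ η))
    (β τ δ : ℝ) (h1 : 1 < τ) (h2 : τ < 2) (hβ : τ < β) (hδ : 0 < δ)
    (hP : SmallValueHyp ξ η β τ (2 + β - τ + δ)) : HasOrbitLinks ξ η β τ δ := by
  classical
  /- ───── exponents ───── -/
  obtain ⟨ν, hνdef⟩ : ∃ ν : ℝ, ν = 2 + β - τ + δ := ⟨_, rfl⟩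
  rw [← hνdef] at hP
  have hτ1 : 1 ≤ τ := h1.le
  have hβ1 : 1 < β := lt_of_le_of_lt hτ1 hβ
  have hβ0 : 0 < β := by linarith
  have hτ0 : 0 < τ := by linarith
  have hδdef : δ = ν + τ - 2 - β := by rw [hνdef]; ring
  have hν2 : 2 < ν := by linarith
  have hν1 : 1 < ν := by linarith
  have hτν : τ < ν := by linarith
  have h2β : 2 + β < τ + ν := by linarith
  have h3 : 3 < τ + ν := by linarith
  have hν' : 2 + β - τ < ν := by linarith
  /- ───── constants ───── -/
  have hc2 : 1 ≤ roy_c2 ξ η := one_le_roy_c2 ξ η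
  have hcI : (1 : ℝ) ≤ 3 * (1 + ‖ξ‖ + ‖η‖⁻¹) := by
    have : 0 ≤ ‖ξ‖ := norm_nonneg _; have : 0 ≤ ‖η‖⁻¹ := inv_nonneg.mpr (norm_nonneg _); linarith
  have hM1 : (1 : ℝ) ≤ max 1 ‖ξ‖ * max 1 ‖η‖⁻¹ :=
    one_le_mul_of_one_le_of_one_le (le_max_left _ _) (le_max_left _ _)
  obtain ⟨A₃, hA₃⟩ : ∃ A₃ : ℝ, A₃ = 74 * (2 : ℝ) ^ (1 + β - τ) := ⟨_, rfl⟩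
  obtain ⟨κ, hκ⟩ : ∃ κ : ℝ, κ = 1 / 1280 := ⟨_, rfl⟩
  have hκ0 : 0 < κ := by rw [hκ]; norm_num
  obtain ⟨C, hC⟩ : ∃ C : ℝ, C = max 1280 (74 * (2 : ℝ) ^ (1 + β - τ)) := ⟨_, rfl⟩
  have hC1280 : (1280 : ℝ) ≤ C := by rw [hC]; exact le_max_left _ _
  have hCA₃ : A₃ ≤ C := by rw [hC, hA₃]; exact le_max_right _ _
  have hC8 : (8 : ℝ) ≤ C := by linarith
  have hC1 : (1 : ℝ) ≤ C := by linarith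
  have hC0 : 0 < C := by linarith
  /- ───── the sequence ───── -/
  obtain ⟨D₀, hD₀⟩ := eventually_atTop.mp hP
  choose! P hP0 hPdeg hPht hPval using hD₀
  /- ───── thresholds ───── -/
  have hev := ((((((((((((((eventually_ge_atTop (max D₀ 5)).and
    (eventually_36_mul_natFloor_le_sq h2)).and (eventually_natFloor_le_choose h2)).and
    eventually_sq_lt_two_pow).and (eventually_step1_norm hβ hβ0)).and
    (eventually_step1_value hτν hν1 hM1)).and (eventually_levelQ_norm hβ1)).and
    (eventually_levelQ_value hν1)).and (eventually_interp_const hτ0 hβ hcI)).and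
    (eventually_log_eps hτ0.le h2β h3)).and (eventually_N_log_N hβ0)).and
    (eventually_gamma_le_rpow ξ η hτ0 hβ)).and
    (eventually_step4_big (c := Real.log 2 + 2 * roy_c2 ξ η ^ 2) (A₃ := A₃) hτ1 hν' hβ)).and
    (eventually_step4_const (c := Real.log (roy_c4 ξ η)) hβ1)).and
    (eventually_exp_neg_lt (e := ν - 2) hκ0 (by linarith only [hν2])
      (show 0 < ‖η‖ / (2 * roy_c2 ξ η ^ 2) by have := norm_pos_iff.mpr hη; positivity))
  obtain ⟨D₁, hD₁⟩ := eventually_atTop.mp hev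
  /- ───── the integer parameters `T n = ⌊n^τ⌋`, and facts for `n ≥ D₁` ───── -/
  obtain ⟨Tn, hTn⟩ : ∃ Tn : ℕ → ℕ, Tn = fun n : ℕ => ⌊((n : ℕ) : ℝ) ^ τ⌋₊ := ⟨_, rfl⟩
  have hTn' : ∀ n : ℕ, ⌊((n : ℕ) : ℝ) ^ τ⌋₊ = Tn n := fun n => by rw [hTn]
  have hD₀le : ∀ n, D₁ ≤ n → D₀ ≤ n := fun n hn =>
    le_trans (le_max_left _ _) (hD₁ n hn).1.1.1.1.1.1.1.1.1.1.1.1.1.1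
  have h5le : ∀ n, D₁ ≤ n → 5 ≤ n := fun n hn =>
    le_trans (le_max_right _ _) (hD₁ n hn).1.1.1.1.1.1.1.1.1.1.1.1.1.1
  have h1le : ∀ n, D₁ ≤ n → 1 ≤ n := fun n hn => le_trans (by norm_num) (h5le n hn)
  have hTge : ∀ n, n ≤ Tn n := fun n => by rw [hTn]; exact self_le_natFloor_rpow hτ1 n
  have hT1 : ∀ n, D₁ ≤ n → 1 ≤ Tn n := fun n hn => le_trans (h1le n hn) (hTge n)
  have hT2 : ∀ n, D₁ ≤ n → (n : ℝ) ^ τ ≤ 2 * Tn n := fun n hn => by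
    rw [hTn]; exact rpow_le_two_mul_natFloor (h1le n hn) hτ0.le
  have hchoose : ∀ n, D₁ ≤ n → Tn n ≤ (n + 1).choose 2 := fun n hn => by
    rw [← hTn']; exact (hD₁ n hn).1.1.1.1.1.1.1.1.1.1.1.1.2
  /- the forms `P̃_n` -/
  obtain ⟨Pt, hPt⟩ : ∃ Pt : ℕ → MvPolynomial (Fin 3) ℤ,
      Pt = fun n => if h : D₀ ≤ n then royTilde n (hP0 n h) else 0 := ⟨_, rfl⟩
  have hPtn : ∀ n (hn : D₁ ≤ n), Pt n = royTilde n (hP0 n (hD₀le n hn)) := fun n hn => by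
    rw [hPt]; exact dif_pos (hD₀le n hn)
  have hPtZ : ∀ n, D₁ ≤ n → (Pt n).IsHomogeneous n := fun n hn => by
    rw [hPtn n hn]; exact isHomogeneous_royTilde _ (hPdeg n (hD₀le n hn))
  have hPth : ∀ n, D₁ ≤ n → (map (Int.castRingHom ℂ) (Pt n)).IsHomogeneous n := fun n hn => by
    rw [hPtn n hn]; exact isHomogeneous_map_royTilde _ (hPdeg n (hD₀le n hn))
  have hPt0 : ∀ n, D₁ ≤ n → map (Int.castRingHom ℂ) (Pt n) ≠ 0 := fun n hn => by
    rw [hPtn n hn]; exact map_royTilde_ne_zero _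
  /- Step 1: the bodies -/
  have hbody : ∀ n (hn : D₁ ≤ n), ∀ j ≤ 2 * Tn n,
      map (Int.castRingHom ℂ) ((homDK ℤ)^[j] (Pt n)) ∈
        royBody n ξ η (3 * (n : ℝ) ^ β) ((n : ℝ) ^ ν / 4) (Tn n) ∧
      map (Int.castRingHom ℂ) ((homDK ℤ)^[j] (Pt n)) ∈
        royBody n ξ η (2 * (n : ℝ) ^ β) ((n : ℝ) ^ ν / 2) (Tn n) := by
    intro n hn j hj
    have hE := hD₁ n hn
    have hmem := mem_body_of_step1 (hP0 n (hD₀le n hn)) (hPdeg n (hD₀le n hn)) hη (τ := τ) (β := β)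
      (ν := ν) (h1le n hn) j (by rw [hTn'] ; exact hj) (hPht n (hD₀le n hn))
      (fun t ht => hPval n (hD₀le n hn) t (by rw [hTn'] at ht ⊢; omega))
      hE.1.1.1.1.1.1.1.1.1.1.2 hE.1.1.1.1.1.1.1.1.1.2
    rw [hTn', ← hPtn n hn] at hmem
    refine ⟨royBody_mono ?_ ?_ hmem, hmem⟩
    · have h0 : (0 : ℝ) ≤ (n : ℝ) ^ β := Real.rpow_nonneg (Nat.cast_nonneg n) β
      linarith only [h0]
    · have h0 : (0 : ℝ) ≤ (n : ℝ) ^ ν := Real.rpow_nonneg (Nat.cast_nonneg n) ν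
      linarith only [h0]
  have hPmem : ∀ n, D₁ ≤ n → map (Int.castRingHom ℂ) (Pt n) ∈
      royBody n ξ η (3 * (n : ℝ) ^ β) ((n : ℝ) ^ ν / 4) (Tn n) := fun n hn => by
    have := (hbody n hn 0 (Nat.zero_le _)).1
    rwa [Function.iterate_zero_apply] at this
  /- the level packages -/
  have hLne : ∀ n, D₁ ≤ n → Nonempty (LevelPkg n (Pt n)) := fun n hn => by
    have h := nonempty_levelPkg (h1le n hn) (hPth n hn) (hPt0 n hn)
      (by rw [hPtn n hn]; exact not_X_zero_dvd_royTilde _ (hPdeg n (hD₀le n hn)))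
      (by rw [hPtn n hn]; exact not_X_two_dvd_royTilde _)
    exact h
  obtain ⟨Lf, -⟩ : ∃ Lf : ∀ n, D₁ ≤ n → LevelPkg n (Pt n), True :=
    ⟨fun n hn => Classical.choice (hLne n hn), trivial⟩
  /- the companion forms `Q_n` lie in the body -/
  have hQmem : ∀ n (hn : D₁ ≤ n), map (Int.castRingHom ℂ) (levelQ n (Pt n) (Lf n hn).t) ∈
      royBody n ξ η (3 * (n : ℝ) ^ β) ((n : ℝ) ^ ν / 4) (Tn n) := by
    intro n hn
    have hE := hD₁ n hn
    have ht1 := (Lf n hn).one_le_t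
    have htle : (Lf n hn).t ≤ n ^ 2 := (Lf n hn).ht
    have hx1 : (1 : ℝ) ≤ n := by exact_mod_cast h1le n hn
    have htpow : ((Lf n hn).t : ℝ) ^ n ≤ ((n : ℝ) ^ 2) ^ n := by
      exact pow_le_pow_left₀ (Nat.cast_nonneg _) (by exact_mod_cast htle) n
    refine levelQ_mem_royBody ht1 (Y₀ := 2 * (n : ℝ) ^ β) (U₀ := (n : ℝ) ^ ν / 2)
      (fun i hi => ?_) ?_ ?_
    · have hi2 : i ≤ 2 * Tn n := by
        have := (mem_Icc.mp hi).2; have := hTge n; omega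
      have := (hbody n hn i hi2).2
      rw [map_iterate_homDK] at this
      exact this
    · refine le_trans ?_ hE.1.1.1.1.1.1.1.1.2
      have h0 : (0 : ℝ) ≤ (n : ℝ) * Real.exp (2 * (n : ℝ) ^ β) := by positivity
      calc (n : ℝ) * ((Lf n hn).t : ℝ) ^ n * Real.exp (2 * (n : ℝ) ^ β)
          = ((Lf n hn).t : ℝ) ^ n * ((n : ℝ) * Real.exp (2 * (n : ℝ) ^ β)) := by ring
        _ ≤ ((n : ℝ) ^ 2) ^ n * ((n : ℝ) * Real.exp (2 * (n : ℝ) ^ β)) :=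
            mul_le_mul_of_nonneg_right htpow h0
        _ = _ := by ring
    · refine le_trans ?_ hE.1.1.1.1.1.1.1.2
      have h0 : (0 : ℝ) ≤ (n : ℝ) * Real.exp (-((n : ℝ) ^ ν / 2)) := by positivity
      calc (n : ℝ) * ((Lf n hn).t : ℝ) ^ n * Real.exp (-((n : ℝ) ^ ν / 2))
          = ((Lf n hn).t : ℝ) ^ n * ((n : ℝ) * Real.exp (-((n : ℝ) ^ ν / 2))) := by ring
        _ ≤ ((n : ℝ) ^ 2) ^ n * ((n : ℝ) * Real.exp (-((n : ℝ) ^ ν / 2))) :=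
            mul_le_mul_of_nonneg_right htpow h0
        _ = _ := by ring
  /- the separation at the level `D₁ + 1` and the final threshold `D₃` -/
  have hD₁s : D₁ ≤ D₁ + 1 := Nat.le_succ _
  obtain ⟨ε₁, hε₁, hsep⟩ := exists_pdist_lower_bound hna (isHomogeneous_map_rat (hPth _ hD₁s))
    (isHomogeneous_map_rat (isHomogeneous_map_levelQ (hPth _ hD₁s) (Lf _ hD₁s).t))
    (by rw [toCX_map_int]; exact hPt0 _ hD₁s) (by rw [toCX_map_int]; exact (Lf _ hD₁s).hQ0)
    (by rw [toCX_map_int, toCX_map_int]; exact isRelPrime_of_regular (hPt0 _ hD₁s) (Lf _ hD₁s).hPQ)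
  obtain ⟨D₃, hD₃⟩ := eventually_atTop.mp
    (eventually_exp_neg_lt (e := ν - 2) hκ0 (by linarith only [hν2]) hε₁)
  /- ───── the levels `D ≥ max D₃ (D₁ + 2)` ───── -/
  refine ⟨C, hC0, ?_⟩
  rw [Filter.eventually_atTop]
  refine ⟨max D₃ (D₁ + 2), fun D hD => ?_⟩
  have hDD₃ : D₃ ≤ D := le_trans (le_max_left _ _) hD
  have hDD₁ : D₁ + 2 ≤ D := le_trans (le_max_right _ _) hD
  have hD₁D : D₁ ≤ D := by omega
  have hE := hD₁ D hD₁D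
  -- the field `K` containing the coordinates of all the packages of levels `D₁ ≤ n ≤ D`
  obtain ⟨S, hS⟩ : ∃ S : Finset ℂ, S = (Finset.Icc D₁ D).attach.biUnion
      (fun n => (Lf n.1 (mem_Icc.mp n.2).1).coords) := ⟨_, rfl⟩
  have hSalg : ∀ x ∈ S, IsAlgebraic ℚ x := by
    intro x hx
    rw [hS] at hx
    obtain ⟨n, -, hn⟩ := mem_biUnion.mp hx
    exact (Lf n.1 _).isAlgebraic_of_mem_coords hn
  have hKn : ∀ n (hn : D₁ ≤ n) (_ : n ≤ D), ∀ i kk, (Lf n hn).α i kk ∈ closureField S := by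
    intro n hn hnD i kk
    refine mem_closureField hSalg ?_
    rw [hS]
    exact mem_biUnion.mpr ⟨⟨n, mem_Icc.mpr ⟨hn, hnD⟩⟩, mem_attach _ _, (Lf n hn).mem_coords i kk⟩
  -- the package at the level `D`
  obtain ⟨L, hLdef⟩ : ∃ L : LevelPkg D (Pt D), L = Lf D hD₁D := ⟨_, rfl⟩
  have hK : ∀ i kk, L.α i kk ∈ closureField S := by rw [hLdef]; exact hKn D hD₁D le_rfl
  have hQmemD := hQmem D hD₁D
  rw [← hLdef] at hQmemD
  have hd₁pos : ∀ j, 0 < pdist ξ η (supNormalise (L.α j)) := fun j =>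
    L.pdist_supNormalise_pos (hPth D hD₁D) (hPt0 D hD₁D) hna j
  /- ───── Step 2 at the level `D` ───── -/
  obtain ⟨j₀, hvanO, hdist2, hchart, j₁, hj₁O, -, hsmall⟩ := level_step2 hη hna hτ1 h2 hδdef hκ
    (h5le D hD₁D) L (hPth D hD₁D) (hPt0 D hD₁D) (closureField S) hK (hTn' D) (hPmem D hD₁D) hQmemD
    hE.1.1.1.1.1.1.1.1.1.1.1.1.1.2 hE.1.1.1.1.1.1.1.1.1.1.1.2 hE.1.1.1.1.2 hE.1.1.1.1.1.2
    hE.1.1.1.1.1.1.2 hE.1.1.1.2 hE.2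
  have hsmallε : pdist ξ η (supNormalise (L.α j₁)) < ε₁ := lt_of_le_of_lt hsmall (hD₃ D hDD₃)
  /- ───── Steps 3–4 ───── -/
  obtain ⟨Ds, hDs1, hDsD, hdle, hhOle, hstep4⟩ := level_step34 hτ0 h2 hβ hA₃ hTge hT1 hT2 h5le
    hPth hPtZ (fun n hn j hj => (hbody n hn j hj).1) Lf (closureField S) hKn hPmem hQmem hchoose
    (fun n hn => (hD₁ n hn).1.1.1.1.2) (fun n hn => (hD₁ n hn).1.1.2) (fun n hn => (hD₁ n hn).1.2)
    hD₁s hsep hDD₁ L hK hd₁pos j₀ hvanO hchart hj₁O hsmallε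
  /- ───── the orbit link ───── -/
  have hhO0 : 0 ≤ (∑ j ∈ (L.cfg (closureField S) hK).orb j₀,
      logHeight ((L.cfg (closureField S) hK).rep j)) / Module.finrank ℚ (closureField S) :=
    div_nonneg (sum_nonneg fun j _ => logHeight_nonneg _) (Nat.cast_nonneg _)
  have hxs : (0 : ℝ) ≤ Ds := Nat.cast_nonneg _
  have hxD : (0 : ℝ) ≤ D := Nat.cast_nonneg _
  refine ⟨S, L.m, L.cfg (closureField S) hK, j₀, Ds, fun j hj => (hchart j hj).1,
    fun j _ => hd₁pos j, hDs1, hDsD,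
    hdle.trans (mul_le_mul_of_nonneg_right hC8 (Real.rpow_nonneg hxs _)),
    hhOle.trans (mul_le_mul_of_nonneg_right hCA₃ (Real.rpow_nonneg hxs _)), ?_, ?_⟩
  · -- the mass clause (Step 2): `κ = 1/1280 ≥ 1/C`
    dsimp only [orbitHeight, leafCloseness, IsNear]
    rw [hTn' D]
    refine hdist2.trans ?_
    have hB : 0 ≤ (D : ℝ) ^ β * ((L.cfg (closureField S) hK).orb j₀).card +
        D * ((∑ j ∈ (L.cfg (closureField S) hK).orb j₀,
          logHeight ((L.cfg (closureField S) hK).rep j)) / Module.finrank ℚ (closureField S)) :=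
      add_nonneg (mul_nonneg (Real.rpow_nonneg hxD _) (Nat.cast_nonneg _)) (mul_nonneg hxD hhO0)
    have hcoef : (D : ℝ) ^ δ / C ≤ κ * (D : ℝ) ^ δ := by
      rw [div_eq_inv_mul]
      refine mul_le_mul_of_nonneg_right ?_ (Real.rpow_nonneg hxD _)
      rw [hκ, one_div]
      exact inv_anti₀ (by norm_num) hC1280
    exact neg_le_neg (mul_le_mul_of_nonneg_right hcoef hB)
  · -- the Step-4 clause: `C ≥ 8`, `C ≥ 1`
    intro S' hS'
    dsimp only [orbitHeight, leafCloseness, IsNear] at hS' ⊢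
    rw [hTn' Ds]
    refine le_trans ?_ (hstep4 S' hS')
    have hx0 : 0 ≤ (Ds : ℝ) ^ β * ((L.cfg (closureField S) hK).orb j₀).card :=
      mul_nonneg (Real.rpow_nonneg hxs _) (Nat.cast_nonneg _)
    have hy0 : 0 ≤ (Ds : ℝ) * ((∑ j ∈ (L.cfg (closureField S) hK).orb j₀,
        logHeight ((L.cfg (closureField S) hK).rep j)) / Module.finrank ℚ (closureField S)) :=
      mul_nonneg hxs hhO0
    have e1 := mul_le_mul_of_nonneg_right hC8 hx0
    have e2 := mul_le_mul_of_nonneg_right hC1 hy0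
    rw [mul_add]
    linarith only [e1, e2]

end Summit.Schanuel.Schanuel.Theorems.RoyLinks

end
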